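import Mathlib
import Summits.ValiantsHypothesis.ValiantsHypothesis.Theorems.FifoMatchingNNNotVPSupportFnMatchings
import HarnessLib

/-!
# Route FifoMatching — crux `NNNotVP` (stmt-ValiantsHypothesis-11615), line `division_split`:
# the TOKEN GAME of a round-structured arc system (framework for the clique gadget of stub A)

Registered line `Cruxes/NNNotVP/Lines/division_split.lean`; objects `σ` / `NN` / `SuppFn` = the
line's vocabulary (`Theorems/FifoMatchingNNNotVPDivisionSplitDefs.lean`).  Stub A
(`stub_supportFnHard`) is, VERBATIM, implied by a clique-like monotone PROJECTION of nest-free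
perfect-matching existence (`supportFnHard_of_cliqueProjection_seq`, companion
`…SupportFnPadding`): for all large `m` some `n ≤ m^{C₀}` and `e : σ n → E(K_m) ⊕ Bool` under
which NFPM-existence accepts every `⌊√m⌋`-clique vector and rejects every `(⌊√m⌋-1)`-colouring
vector.  This file is the def-free FRAMEWORK THEOREM through which such a projection is to be
built and verified; it contains no gadget yet.

## The round structure and the token game (what is proved here)

Positions: a linear order `P` covered by LAYERS `first` (layer `0`, `k` positions `first i`),
`act j` (layer `2j+1`) and `tok j` (layer `2j+2`) with `N` positions `act j q`, `tok j q` each,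
`j < R`, and `last` (layer `2R+1`, `k` positions); `lay : P → ℕ` monotone, every layer map
increasing.  Availability `x : P × P → Bool` is ROUND-STRUCTURED: the available arcs leave
`first i` only towards `act 0`, `act j q` only towards its twin `tok j q` (and that twin arc IS
available), `tok j q` only towards `act (j+1)` (towards `last` when `j = R-1`, all those final arcs
available), nothing leaves `last`.

* `nonnest_iff_monotone_of_layered` — L1 on a linear order: when all arcs go one layer up,
  nest-free ⟺ increasing on the openers of each layer (`Fin N` version landed in
  `…LayeredMatchings`).
* `tokenPaths_of_matching` (REJECT direction) — a nest-free perfect matching with all arcs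
  available yields `k` TOKEN PATHS: increasing `p j : Fin k → Fin N` (`j < R`) with the arcs
  `first i → act 0 (p 0 i)` and `tok j (p j i) → act (j+1) (p (j+1) i)` available.  (Induction over
  rounds: the openers of token layer `j` are matched increasingly INTO `act j`; the other positions
  of `act j` are openers and go to their twins; so the openers of `tok j` are exactly the twins of
  the closers of `act j` — the queue read round by round; tokens never cross.)
* `matching_of_tokenPaths` (ACCEPT direction) — conversely token paths give such a matching
  (token arcs + twin arcs of the token-free positions + final arcs).
* `nfpmExists_iff_tokenPaths` — both directions for `P = Fin (2n)` in the line's currency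
  `decide (SuppFn (NN n) {a | x a}) = true`.

So on a round-structured instance NFPM-existence IS the existence of `k` non-crossing token paths
along available arcs: a nondeterministic "token program" whose only inter-token constraint is
ORDER.  Everything below is the intended use (design record for successor hands; NOT proved here).

## Instantiating on `Fin (2n)` (next file, ≈ 120 lines, def-free as an `∃`)

Take `C := Fin k ⊕ₗ ((Fin (2R) ×ₗ Fin N) ⊕ₗ Fin k)` (Mathlib `Sum.Lex` / `Prod.Lex`; instances and
`Fintype.card C = 2 (k + R N)` checked), `E := Fintype.orderIsoFinOfCardEq C _ : Fin (2n) ≃o C`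
with `n = k + R N`, `first i := E.symm (inl i)`, `act j q := E.symm (inr (inl (2j, q)))`,
`tok j q := E.symm (inr (inl (2j+1, q)))`, `last i := E.symm (inr (inr i))`, `lay` by cases on
`E a`; all structural hypotheses of this file follow from `Sum.Lex.inl_lt_inr`,
`Prod.Lex.toLex_lt_toLex`, surjectivity of `E.symm`.  A PROGRAM is a labelling
`lab₀ : Fin k → Fin N → L`, `lab : Fin (R-1) → Fin N → Fin N → L`, `L := KEdge m ⊕ Bool`
(`inr false` = no arc); its projection `e : σ n → L` puts `lab₀ i q` on `(first i, act 0 q)`,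
`lab j q q'` on `(tok j q, act (j+1) q')`, `inr true` on twin and final arcs, `inr false` elsewhere;
for an input `y : KEdge m → Bool`, `x := Sum.elim y id ∘ e` is round-structured, and by
`nfpmExists_iff_tokenPaths` NFPM accepts `y` iff the program has a RUN: non-crossing
`p j : Fin k → Fin N` with `lab₀ i (p 0 i)` and `lab j (p j i) (p (j+1) i)` on under `y`.

## The clique program (design; verified informally, to be typed; `k = Nat.sqrt m`)

Position space `Fin N ≃ Fin k ×ₗ Fin m ×ₗ Fin 2 ×ₗ V` (block, bucket, side, value),
`V := Fin m ×ₗ Fin m ×ₗ Fin m` (registers `a` = own vertex, `b` = travelling vertex, `c` =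
staging), `N = 2 k m⁴`; HOME position of token `i` with value `v`: `H i v := (i, 0, 0, v)`.
Rounds (all arcs `inr true` unless said; undescribed pairs `inr false`):
* GUESS (`lab₀`): `first i → H i (a, a, a)`, any `a`.
* for `r = 1, …, k-1` (SHIFT-AND-CHECK round `r`), the sub-rounds
  1. STAGE: `H i (a,b,c) → H i (a,b,c')`, any `c'`;
  2. FILTER-EVEN `≤`: token `2t`: `H (2t) v → (2t, v.b, 0, v)`; token `2t+1`:
     `H (2t+1) w → (2t, w.c, 1, w)` (an unpaired last token stays home).  Non-crossing of the two
     new positions inside block `2t` is EXACTLY `b_{2t} ≤ c_{2t+1}` (`Prod.Lex`); `≥`: the same with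
     buckets `m-1-v.b`, `m-1-w.c`; HOME: back to `H (2t) v`, `H (2t+1) w`;
  3. FILTER-ODD: the same for the pairs `(2t+1, 2t+2)` inside block `2t+1` (token `0`, and the
     last token when unpaired, stay home);  after 2–3: `c_i = b_{i-1}` for all `i ≥ 1`;
  4. COMMIT: `H i (a,b,c) → H i (a,c,c)`;  so `b_i(r) = b_{i-1}(r-1)`, hence `b_i(r) = a_{i-r}`
     for `i ≥ r` (garbage for `i < r`, never read by a check);
  5. CHECK: for `i ≥ r`: `H i (a,b,c) → H i (a,b,c)` labelled `inl {a, b}` if `a ≠ b`,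
     `inr false` if `a = b`; for `i < r`: `inr true`.
  `R = 1 + 9 (k-1)` rounds, `n = k + R N = O(k² m⁴) ≤ m⁶` for large `m` (`C₀ = 6`).
* ACCEPT (`y = cliqueVec Z`, `Z = {z₀ < ⋯ < z_{k-1}}`): the honest run `a_i = z_i`, staging
  guesses `c'_i := b_{i-1}`, passes every filter with equality and every check (`z_i ≠ z_{i-r}`,
  both in `Z`); home layouts are non-crossing because blocks are increasing in `i`.
* REJECT (`y = colorVec O`, `O : Fin m → Fin (k-1)`): in any run the registers decode uniquely
  (every available arc from a token position is a designed one), `a_i` is constant, the two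
  filters force `c_i = b_{i-1}`, so `b_i(r) = a_{i-r}` for `i ≥ r`, and CHECK `r` at token `i ≥ r`
  forces `a_i ≠ a_{i-r}` and `O a_i ≠ O a_{i-r}`; over all `r` this makes `O ∘ a` injective
  `Fin k → Fin (k-1)` — impossible (`Fintype.card_le_of_injective`).  (`k ≥ 2` for `m ≥ 4`.)

Remaining lemma list (sizes): instance on `Fin (2n)` ≈ 120 l; Defs file for the program
(`lab₀`, `lab`, `H`, decoders) ≈ 150 l; run semantics per sub-round (STAGE/FILTER/HOME/COMMIT/
CHECK: "position after = designed target of position before", bucket inequality from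
`StrictMono`) ≈ 350 l; ACCEPT ≈ 150 l; REJECT ≈ 200 l; plug into
`supportFnHard_of_cliqueProjection_seq 6` with the size estimate ≈ 60 l.

Honest framing: a framework theorem (pure combinatorics of nest-free matchings); the gadget is NOT
constructed here, stubs Z / A / B2, the crux `NNNotVP` and `VP ≠ VNP` stay OPEN (NOT proved).  No
definitions, no named facts.
-/

-- Sub = Summit single-conjunct layout: the duplicated namespace component is mandated by the tree.
set_option linter.dupNamespace false

namespace Summit.ValiantsHypothesis.ValiantsHypothesis.Theorems.FifoMatching.NNNotVP.DivisionSplit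

open Finset Literature.Computability.AlgebraicComplexity

section Layered

variable {P : Type*} [LinearOrder P]

/-- **Layered matchings on a linear order: nest-free iff increasing on the openers of each layer**
(the `Fin N` version is `mem_nestFreeMatchings_iff_monotone_of_layered`).  `lay` is monotone and
every arc of the fixed-point-free involution `M` goes from a layer to the next one. [folklore] -/
theorem nonnest_iff_monotone_of_layered (lay : P → ℕ) (hlay : Monotone lay) {M : P → P}
    (hinv : ∀ a, M (M a) = a) (harcs : ∀ a, a < M a → lay (M a) = lay a + 1) :
    (∀ a b, a < b → b < M b → M b < M a → False) ↔
      ∀ a b, a < b → a < M a → b < M b → lay a = lay b → M a < M b := by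
  constructor
  · intro hnest a b hab ha hb _
    rcases lt_trichotomy (M a) (M b) with h | h | h
    · exact h
    · exact absurd (by rw [← hinv a, h, hinv b] : a = b) (ne_of_lt hab)
    · exact (hnest a b hab hb h).elim
  · intro hmono a b hab hb hba
    have ha : a < M a := lt_trans hab (lt_trans hb hba)
    have h1 : lay a ≤ lay b := hlay hab.le
    have h2 : lay (M b) ≤ lay (M a) := hlay hba.le
    rw [harcs a ha, harcs b hb] at h2
    have heq : lay a = lay b := le_antisymm h1 (by omega)
    exact absurd (hmono a b hab ha hb heq) (not_lt.2 hba.le)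

end Layered

section TokenGame

variable {P : Type*} [LinearOrder P] {k R N : ℕ}
variable {first : Fin k → P} {act tok : Fin R → Fin N → P} {last : Fin k → P} {lay : P → ℕ}

/-- In a round structure, a position of odd layer `2j+1 < 2R+1` is an active position `act j q`.
[folklore] -/
theorem eq_act_of_lay
    (h0 : ∀ i, lay (first i) = 0) (hA : ∀ j q, lay (act j q) = 2 * j + 1)
    (hT : ∀ j q, lay (tok j q) = 2 * j + 2) (hL : ∀ i, lay (last i) = 2 * R + 1)
    (hcov : ∀ a, (∃ i, a = first i) ∨ (∃ j q, a = act j q) ∨ (∃ j q, a = tok j q) ∨ (∃ i, a = last i))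
    {a : P} {j : ℕ} (hj : j < R) (ha : lay a = 2 * j + 1) : ∃ q, a = act ⟨j, hj⟩ q := by
  rcases hcov a with ⟨i, rfl⟩ | ⟨j', q, rfl⟩ | ⟨j', q, rfl⟩ | ⟨i, rfl⟩
  · rw [h0] at ha; omega
  · rw [hA] at ha
    have : j' = ⟨j, hj⟩ := Fin.ext (by simp at ha ⊢; omega)
    subst this; exact ⟨q, rfl⟩
  · rw [hT] at ha; omega
  · rw [hL] at ha; omega

/-- In a round structure, a position of even layer `2j+2 ≤ 2R` is a token position `tok j q`.
[folklore] -/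
theorem eq_tok_of_lay
    (h0 : ∀ i, lay (first i) = 0) (hA : ∀ j q, lay (act j q) = 2 * j + 1)
    (hT : ∀ j q, lay (tok j q) = 2 * j + 2) (hL : ∀ i, lay (last i) = 2 * R + 1)
    (hcov : ∀ a, (∃ i, a = first i) ∨ (∃ j q, a = act j q) ∨ (∃ j q, a = tok j q) ∨ (∃ i, a = last i))
    {a : P} {j : ℕ} (hj : j < R) (ha : lay a = 2 * j + 2) : ∃ q, a = tok ⟨j, hj⟩ q := by
  rcases hcov a with ⟨i, rfl⟩ | ⟨j', q, rfl⟩ | ⟨j', q, rfl⟩ | ⟨i, rfl⟩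
  · rw [h0] at ha; omega
  · rw [hA] at ha; omega
  · rw [hT] at ha
    have : j' = ⟨j, hj⟩ := Fin.ext (by simp at ha ⊢; omega)
    subst this; exact ⟨q, rfl⟩
  · rw [hL] at ha; omega

/-- **Token paths from a matching (the `reject` direction of the token game).**  Round structure on
a linear order `P`: layers `first` (layer `0`, `k` positions), `act j` (layer `2j+1`) and `tok j`
(layer `2j+2`) of `N` positions each for `j < R`, `last` (layer `2R+1`, `k` positions), `lay`
monotone, each layer map increasing, the layers covering `P`; availability `x` such that the only
available arcs leave `first` towards `act 0`, `act j q` towards its twin `tok j q`, `tok j` towards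
`act (j+1)` (resp. `last` for `j = R-1`), and none leaves `last`.  Then every nest-free perfect
matching of `P` all of whose arcs are available yields `k` token paths: increasing maps
`p j : Fin k → Fin N` (`j < R`) with the arcs `first i → act 0 (p 0 i)` and
`tok j (p j i) → act (j+1) (p (j+1) i)` available. [folklore] -/
theorem tokenPaths_of_matching (hR : 0 < R) (hmono : Monotone lay)
    (h0 : ∀ i, lay (first i) = 0) (hA : ∀ j q, lay (act j q) = 2 * j + 1)
    (hT : ∀ j q, lay (tok j q) = 2 * j + 2) (hL : ∀ i, lay (last i) = 2 * R + 1)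
    (hfirst : StrictMono first) (hact : ∀ j, StrictMono (act j)) (htok : ∀ j, StrictMono (tok j))
    (hcov : ∀ a, (∃ i, a = first i) ∨ (∃ j q, a = act j q) ∨ (∃ j q, a = tok j q) ∨ (∃ i, a = last i))
    (x : P × P → Bool)
    (xF : ∀ i b, first i < b → x (first i, b) = true → ∃ q, b = act ⟨0, hR⟩ q)
    (xA : ∀ j q b, act j q < b → x (act j q, b) = true → b = tok j q)
    (xT : ∀ j q b, tok j q < b → x (tok j q, b) = true →
      (∃ h : j.val + 1 < R, ∃ q', b = act ⟨j.val + 1, h⟩ q') ∨ (j.val + 1 = R ∧ ∃ i, b = last i))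
    (xL : ∀ i b, last i < b → x (last i, b) = true → False)
    {M : P → P} (hinv : ∀ a, M (M a) = a) (hfp : ∀ a, M a ≠ a)
    (hnest : ∀ a b, a < b → b < M b → M b < M a → False)
    (hon : ∀ a, a < M a → x (a, M a) = true) :
    ∃ p : Fin R → Fin k → Fin N, (∀ j, StrictMono (p j)) ∧
      (∀ i, x (first i, act ⟨0, hR⟩ (p ⟨0, hR⟩ i)) = true) ∧
      ∀ (j : Fin R) (h : j.val + 1 < R) (i : Fin k),
        x (tok j (p j i), act ⟨j.val + 1, h⟩ (p ⟨j.val + 1, h⟩ i)) = true := by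
  -- every arc goes one layer up
  have harcs : ∀ a, a < M a → lay (M a) = lay a + 1 := by
    intro a ha
    have hx := hon a ha
    rcases hcov a with ⟨i, rfl⟩ | ⟨j, q, rfl⟩ | ⟨j, q, rfl⟩ | ⟨i, rfl⟩
    · obtain ⟨q, hq⟩ := xF i _ ha hx
      rw [hq, hA, h0]; dsimp only
    · rw [xA j q _ ha hx, hT, hA]
    · rcases xT j q _ ha hx with ⟨h, q', hq'⟩ | ⟨h, i, hi⟩
      · rw [hq', hA, hT]; dsimp only; omega
      · rw [hi, hL, hT]; omega
    · exact (xL i _ ha hx).elim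
  have hlmono := (nonnest_iff_monotone_of_layered lay hmono hinv harcs).1 hnest
  -- opener criterion: a position into which no available arc can be matched is an opener
  have hopener : ∀ a, (∀ b, b < a → x (b, a) = true → M b ≠ a) → a < M a := by
    intro a h
    rcases lt_or_gt_of_ne (hfp a) with hlt | hgt
    · have hb : M a < M (M a) := by rw [hinv]; exact hlt
      have hx := hon (M a) hb
      rw [hinv] at hx
      exact absurd (hinv a) (h (M a) hlt hx)
    · exact hgt
  -- injectivity of the layer maps `act j`, `tok j` in both indices
  have hact_inj : ∀ {j j' : Fin R} {q q' : Fin N}, act j q = act j' q' → j = j' ∧ q = q' := by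
    intro j j' q q' h
    have hl := congrArg lay h
    rw [hA, hA] at hl
    have hj : j = j' := Fin.ext (by omega)
    subst hj
    exact ⟨rfl, (hact j).injective h⟩
  have htok_inj : ∀ {j j' : Fin R} {q q' : Fin N}, tok j q = tok j' q' → j = j' ∧ q = q' := by
    intro j j' q q' h
    have hl := congrArg lay h
    rw [hT, hT] at hl
    have hj : j = j' := Fin.ext (by omega)
    subst hj
    exact ⟨rfl, (htok j).injective h⟩
  -- the twin map `act j q ↦ tok j q`
  classical
  let nxt : P → P := fun a =>
    if h : ∃ jq : Fin R × Fin N, a = act jq.1 jq.2 then tok h.choose.1 h.choose.2 else a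
  have hnxt : ∀ j q, nxt (act j q) = tok j q := by
    intro j q
    have h : ∃ jq : Fin R × Fin N, act j q = act jq.1 jq.2 := ⟨(j, q), rfl⟩
    simp only [nxt, dif_pos h]
    obtain ⟨h1, h2⟩ := hact_inj h.choose_spec
    rw [← h1, ← h2]
  -- the token positions, round by round
  let pos : ℕ → Fin k → P := fun j => Nat.rec first (fun _ g i => nxt (M (g i))) j
  have hpos0 : pos 0 = first := rfl
  have hposS : ∀ j i, pos (j + 1) i = nxt (M (pos j i)) := fun j i => rfl
  -- one round: openers of token layer `j` ↦ closers of `act j` ↦ openers of token layer `j+1`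
  have step : ∀ (j : ℕ) (hj : j < R) (g : Fin k → P), StrictMono g → (∀ i, g i < M (g i)) →
      (∀ i, lay (g i) = 2 * j) →
      ∃ q : Fin k → Fin N, StrictMono q ∧ (∀ i, M (g i) = act ⟨j, hj⟩ (q i)) ∧
        StrictMono (fun i => nxt (M (g i))) ∧ (∀ i, nxt (M (g i)) < M (nxt (M (g i)))) ∧
        (∀ i, lay (nxt (M (g i))) = 2 * (j + 1)) ∧ (∀ i, nxt (M (g i)) = tok ⟨j, hj⟩ (q i)) := by
    intro j hj g hg hop hlay
    have hMg : ∀ i, ∃ q, M (g i) = act ⟨j, hj⟩ q := fun i =>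
      eq_act_of_lay h0 hA hT hL hcov hj (by rw [harcs _ (hop i), hlay])
    choose q hq using hMg
    have hq_mono : StrictMono q := by
      intro i i' hii'
      have h := hlmono (g i) (g i') (hg hii') (hop i) (hop i') (by rw [hlay, hlay])
      rw [hq, hq] at h
      exact (hact _).lt_iff_lt.1 h
    have hnx : ∀ i, nxt (M (g i)) = tok ⟨j, hj⟩ (q i) := fun i => by rw [hq, hnxt]
    refine ⟨q, hq_mono, hq, ?_, ?_, ?_, hnx⟩
    · intro i i' hii'
      show nxt (M (g i)) < nxt (M (g i'))
      rw [hnx, hnx]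
      exact htok _ (hq_mono hii')
    · intro i
      rw [hnx]
      apply hopener
      intro b hb hxb hMb
      have hbo : b < M b := by rw [hMb]; exact hb
      have hlb : lay b = 2 * j + 1 := by
        have := harcs b hbo
        rw [hMb, hT] at this
        simp at this; omega
      obtain ⟨q', rfl⟩ := eq_act_of_lay h0 hA hT hL hcov hj hlb
      have hqq : q' = q i := (htok_inj (xA _ _ _ hb hxb).symm).2
      rw [hqq, ← hq, hinv] at hMb
      have := congrArg lay hMb
      rw [hlay, hT] at this
      dsimp only at this; omega
    · intro i
      rw [hnx, hT]; dsimp only; omega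
  -- all rounds
  have good : ∀ j, j ≤ R → StrictMono (pos j) ∧ (∀ i, pos j i < M (pos j i)) ∧
      (∀ i, lay (pos j i) = 2 * j) := by
    intro j
    induction j with
    | zero =>
      intro _
      refine ⟨hfirst, fun i => ?_, fun i => by rw [hpos0, h0]⟩
      rw [hpos0]
      apply hopener
      intro b hb hxb hMb
      have hbo : b < M b := by rw [hMb]; exact hb
      have := harcs b hbo
      rw [hMb, h0] at this
      omega
    | succ j ih =>
      intro hj
      obtain ⟨hg, hop, hlay'⟩ := ih (by omega)
      obtain ⟨q, -, -, hmono', hop', hlay'', -⟩ := step j (by omega) (pos j) hg hop hlay'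
      refine ⟨?_, ?_, ?_⟩
      · intro i i' h
        rw [hposS, hposS]
        exact hmono' h
      · intro i
        rw [hposS]
        exact hop' i
      · intro i
        rw [hposS]
        exact hlay'' i
  -- the index maps
  have hQ : ∀ (j : ℕ) (hj : j < R), ∃ q : Fin k → Fin N, StrictMono q ∧
      (∀ i, M (pos j i) = act ⟨j, hj⟩ (q i)) ∧ (∀ i, pos (j + 1) i = tok ⟨j, hj⟩ (q i)) := by
    intro j hj
    obtain ⟨hg, hop, hlay'⟩ := good j hj.le
    obtain ⟨q, hqm, hq, -, -, -, hnx⟩ := step j hj (pos j) hg hop hlay'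
    exact ⟨q, hqm, hq, fun i => by rw [hposS, hnx]⟩
  choose Q hQm hQact hQtok using hQ
  refine ⟨fun j => Q j.val j.isLt, fun j => hQm j.val j.isLt, fun i => ?_, fun j h i => ?_⟩
  · have h1 := hQact 0 hR i
    have hop : pos 0 i < M (pos 0 i) := (good 0 (Nat.zero_le _)).2.1 i
    have hx := hon _ hop
    rw [h1, hpos0] at hx
    exact hx
  · have h1 := hQtok j.val j.isLt i
    have h2 := hQact (j.val + 1) h i
    have hop : pos (j.val + 1) i < M (pos (j.val + 1) i) := (good (j.val + 1) h.le).2.1 i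
    have hx := hon _ hop
    rw [h2, h1] at hx
    exact hx

end TokenGame

end Summit.ValiantsHypothesis.ValiantsHypothesis.Theorems.FifoMatching.NNNotVP.DivisionSplit
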